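import Literature.NumberTheory.LFunctions.Zhang2022.RepairTheta
import Literature.NumberTheory.LFunctions.Zhang2022.RepairCoverFrame

/-!
# Zhang (2022), repair rung F-S1R: the admissible class `R` of design parameters `θ`

Y. Zhang, *Discrete mean estimates and the Landau–Siegel zero*, arXiv:2211.02515v1 (2022)
[Zhang2022LandauSiegel] — an unrefereed manuscript under adjudication; this file asserts nothing about
its Theorems 1–2 and nothing about Landau–Siegel zeros.

The repair rung (human ruling D-0077) reads the failing numerical step of §18
(`Skeleton.Margin232`, refuted at the printed parameters) as a functional of the design parameters
`θ : Repair.Theta` (`RepairTheta.lean`: the mollifier exponents `ν₁, ν₂, ν₃` of (2.21), the shift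
multipliers `k₁, k₂, k₃` of (2.22)–(2.25), the coefficients `ι₂, ι₃, ι₄` of (2.26), the cut `cut₁` of
(12.1)) and asks two questions about ONE class `R` of parameters: is there `θ ∈ R` at which the
printed margin holds (repair-in-class), or is the margin functional bounded below on all of `R`
(barrier-in-class). This file types the class.

## What "admissible" means here

`R` = the parameters at which every EXPLICIT side condition / range split of the manuscript's
§§7–18 that mentions `P₁, P₂, P₃`, the split at `P^{1/2}`, `β₆, β₇` holds for all sufficiently large
`D` — i.e. the region on which the printed closed forms (8.19)–(8.23), (9.3)–(9.7), (12.10)–(12.17),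
Lemma 15.1, (17.4), (18.1) ARE the manuscript's main terms AS ARCHITECTED (same case structure, same
ranges). Each side condition compares two quantities of the form `P^{a}T^{b}D^{c}t₀^{d}` with
`P = e^{𝓛⁹}`, `T = e^{𝓛^{1.1}}`, `t₀ = 𝓛⁵¹⁹`, `𝓛 = log D` (§2, §6): for large `D` it holds iff the
`P`-exponents compare STRICTLY, or compare with equality and the printed `T`-power points the right
way. This turns every side condition into a (strict or non-strict) linear inequality among
`ν₁, ν₂, ν₃, k₁, k₂, k₃, cut₁`, typed below as one named conjunct per condition, with its locator
(display, tex line of `lsz3__2_.tex`, typed decl of the audit tree where one exists):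

| conjunct | inequality | source |
|---|---|---|
| `orderedLengths` | `ν₃ < ν₂ < ν₁` | the range splits `Σ_{dr<P₂} + Σ_{P₂≤dr<P₁}` (§8 after (8.18), tex L2438–2455), `Σ_{dr<P₃} + Σ_{P₃≤dr<P₂}` (§9, L2615–2616); `P₃ ≤ P₂ = P^{ν₂}T^{−10}` forces `ν₃ < ν₂` strictly; the tent `f̃` of (2.28) lives on `[ν₂, ν₁]` (§10 (10.6), L2754–2758), non-degenerate iff `ν₂ < ν₁` |
| `straddleHalf` | `ν₃ < 1/2`, `ν₂ ≤ 1/2` (the numerics box `R₀` of the cell scans the face `ν₂ = 1/2`), `1/2 < ν₁` | (12.1)–(12.2) `H₁₁ = Σ_{n<P^{1/2}} + Σ_{P^{1/2}≤n<P₁}`, `B = (H₁₄ + ι₂H₁₂)H₂` (L3362–3370): the second sum is non-empty iff `1/2 < ν₁`; the factors of `H₂` lie below `P^{1/2}η/T²` (`TypedSection15A`, the thresholds `hthr2 : P₂ ≤ P^{1/2}η/T²`, `hthr3 : P^{0.498}T² ≤ P^{1/2}`, l.797–815): `ν₂ ≤ 1/2` (the printed `T^{−10}` of `P₂` points the right way)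 and `ν₃ < 1/2` strictly |
| `belowP` | `ν₁ < 1` | (7.2) "`a(n) = 0` if `n ≥ PT⁻²`" (L1814; `Skeleton.Adm72`) for the coefficient sequence of `H₁₁` (§8, L2293); Lemmas 8.2/8.4 "Suppose `T < x < P`" (L2339, L2392) at `x = P₁/dr` |
| `dualRangesNonempty` | `1 < ν₁ + ν₃` | the ranges `P″₁ < dr < P₂`, `Σ_{P^{0.496}<n<P^{0.498}}` of Lemmas 12.1/12.3 and (12.13) with `P″₁ = P^{1−ν₁}Dt₀` (L3432, L3487–3489, L3551, L3606–3613): non-empty as architected iff `1 − ν₁ < ν₃` (whence also `1 − ν₁ < ν₂`); printed lengths `ν₁ + ν₃ − 1 = 0.002`, `ν₁ + ν₂ − 1 = 0.004` (`Repair.Theta.L6/L7`) |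
| `cutAtHalf` | `cut₁ = 1/2` | (12.1) prints the cut as the literal `P^{1/2}` (L3362); its reflection is `P″₂ = P^{0.5}Dt₀` (L3432) |
| `shiftsInContour` | `0 < k_μ < 5` | the residue contours `|s| = 5α` of Lemmas 8.2/8.4 (L2359, L2367) and 12.2/12.3 (L3535, L3566) must enclose the poles at `β_μ = ik_μα` (resp. `β₆ − w`, `|w| = α`), and Lemmas 15.2/16.1 ask `|s − 1| < 5α` (L4333, L4579); `k_μ ≠ 0` because `𝔤_{jμ}` of Lemma 8.4 carries `β_μ²` in a denominator (L2392–2396). SOFT: `5` is the write-up's radius — any bounded `k` is accommodated by enlarging the circles (Lemma 5.8's annulus `α ≤ |s−1| ≤ 10α`, L1611, is what the expansions need); Proposition 14.1's "`|β| < 5α`" (L3841) concerns `β ∈ {0, β₁, β₃}` ((13.8)–(13.10)), not `k` |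
| `tiedOuterShifts` | `k₁ = k₃` | (2.23) and (2.25) both carry `β₆` (L583, L589); every §§12–17 display is written with one `β₆` |

What is deliberately NOT a conjunct (recorded so that reviewers see the choice): no inequality of
print caps `ν₁` from above other than `ν₁ < 1`, nor `ν₃` other than `ν₃ < 1/2` — §2 "A heuristic
argument" (L511–522) asks only for lengths "close to `1/2` in the logarithmic scale", unquantified;
`ι₂, ι₃, ι₄` are free in `ℂ³` ((2.26) calls them "numerical constants"); the three-shift design
`β₁, β₂, β₃ = iα, 2iα, 3iα`, the weights, the tent tie `[ν₂, (ν₁+ν₂)/2, ν₁]`, the `T`-power of `P₂`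
and the reading `𝔳𝔨₄ := 𝔳𝔨₂` are baked into the functionals (`RepairTheta` module docstring), not
constrained here. The ε-windows of Lemmas 12.1/12.3 and (12.14)–(12.16), false as printed already at
`θ₀` (`Numerics.not_lemma121Pointwise_num_one` etc.) and widening with `ν₁ − 1/2`, are error terms,
not side conditions, and are not part of `R`. The wording of each conjunct follows the cell's
SCOPE memo (HOME/repair/SCOPE.md, sz-skel); a conjunct the memo words differently is superseded by a
later file, never edited here.

## Contents

* the conjuncts above and `AdmissibleTheta θ` (their conjunction);
* `admissible_theta0`, `admissible_thetaIota`: the printed point and the whole printed-exponent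
  `ι`-family (`Section18AllIota`) lie in the class — the class is not empty, and the four exclusions
  of record are statements about its printed fiber;
* `Theta.coords` (the seven real coordinates as a point of `ℕ → ℝ`), `rootBox` (a rational box),
  `coords_mem_rootBox : AdmissibleTheta θ → rootBox.mem θ.coords` — the OUTER-BOX lemma the interval
  cover of the barrier side consumes (`Literature.Analysis.ValidatedNumerics.Box`, `KdCert.sound`);
* `forall_admissible_of_forall_rootBox`: a property of the coordinates proved on the whole root box
  holds on the class;
* `admissibleLinCons` (the closure of `R` as a list of affine constraints `Σ aᵢxᵢ ≤ d` in the
  format `LinCon` of `RepairCoverFrame` — what the cover's linear excluder `linExcl` eats),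
  `linHolds_of_admissible`, `admissible_coverHyp` and `forall_admissible_of_cover`: the hypotheses
  of `RepairCoverFrame.forall_class_of_cover` discharged for this class, so that a certified cover
  of `rootBox` (leaves outside the polytope excluded) yields a statement `∀ θ, AdmissibleTheta θ → …`;
  `forall_admissible_in_of_cover` / `forall_admissible_covered_of_cover`: the same for a compact
  design sub-box `K` (resp. finitely many boxes) — the shape a numerically certified floor takes.

Pure definitions and linear arithmetic; no analytic content, no new `Prop` facts.
-/

noncomputable section

open Real
open Literature.Analysis.ValidatedNumerics (Box KdCert)

namespace Literature.NumberTheory.LFunctions.Zhang2022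

namespace Repair

/-! ### The side conditions, one conjunct each -/

/-- ORDER of the three lengths as architected: `P₃ < P₂ ≤ P₁` with the §8/§9 range splits
`Σ_{dr<P₂} + Σ_{P₂≤dr<P₁}`, `Σ_{dr<P₃} + Σ_{P₃≤dr<P₂}` and a non-degenerate tent `[ν₂, ν₁]` (2.28):
`ν₃ < ν₂ < ν₁` (`P₃ ≤ P^{ν₂}T^{−10}` is strict in the exponent).
[cite: Zhang2022LandauSiegel, §8 after (8.18); §9 after (9.2); §2 (2.28)] -/
def Theta.orderedLengths (θ : Theta) : Prop := θ.nu3 < θ.nu2 ∧ θ.nu2 < θ.nu1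

/-- The lengths STRADDLE `P^{1/2}`: `P₃T² ≤ P^{1/2}` and `P₂ ≤ P^{1/2}η/T²` (the second factor of
`B = (H₁₄ + ι₂H₁₂)H₂`, (12.2); `TypedSection15A` thresholds) and `P^{1/2} < P₁` ((12.1): the sum
`H₁₅ = Σ_{P^{1/2} ≤ n < P₁}` is non-empty): `ν₃ < 1/2`, `ν₂ ≤ 1/2`, `1/2 < ν₁`.
[cite: Zhang2022LandauSiegel, §12 (12.1)–(12.2); §15] -/
def Theta.straddleHalf (θ : Theta) : Prop := θ.nu3 < 1 / 2 ∧ θ.nu2 ≤ 1 / 2 ∧ 1 / 2 < θ.nu1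

/-- Every mollifier is supported below `PT⁻²` ((7.2), the hypothesis of Proposition 7.1 / Lemma 8.1
for the coefficients of `H₁₁`), and Lemmas 8.2/8.4 are applied at `x = P₁/dr < P`: `ν₁ < 1`.
[cite: Zhang2022LandauSiegel, §7 (7.2); §8 Lemmas 8.2, 8.4] -/
def Theta.belowP (θ : Theta) : Prop := θ.nu1 < 1

/-- The DUAL ranges of §12 are non-empty as architected: `P″₁ = P^{1−ν₁}Dt₀ < P₃ (< P₂)`, the ranges
`P″₁ < dr < P₂` of Lemmas 12.1/12.3 and `Σ_{P^{1−ν₁} < n < P^{ν₃}}` of (12.13): `1 < ν₁ + ν₃`.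
[cite: Zhang2022LandauSiegel, §12 Lemmas 12.1, 12.3, (12.13)] -/
def Theta.dualRangesNonempty (θ : Theta) : Prop := 1 < θ.nu1 + θ.nu3

/-- The cut of (12.1) is printed as the literal `P^{1/2}` (reflected: `P″₂ = P^{0.5}Dt₀`): `cut₁ = 1/2`.
[cite: Zhang2022LandauSiegel, §12 (12.1)] -/
def Theta.cutAtHalf (θ : Theta) : Prop := θ.cut1 = 1 / 2

/-- The shifts lie INSIDE THE RESIDUE CONTOURS `|s| = 5α` of Lemmas 8.2/8.4/12.2/12.3 (and
`|s − 1| < 5α` of Lemmas 15.2/16.1): `0 < k_μ < 5` for `μ = 1, 2, 3` (`k_μ ≠ 0`: Lemma 8.4's `𝔤_{jμ}`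
has `β_μ²` in a denominator). The bound `5` is the write-up's radius, a soft constant (module
docstring). [cite: Zhang2022LandauSiegel, §8 Lemmas 8.2, 8.4; §12 Lemmas 12.2, 12.3] -/
def Theta.shiftsInContour (θ : Theta) : Prop :=
  (0 < θ.k1 ∧ θ.k1 < 5) ∧ (0 < θ.k2 ∧ θ.k2 < 5) ∧ (0 < θ.k3 ∧ θ.k3 < 5)

/-- `H₁₁` and `H₁₃` carry THE SAME shift `β₆` ((2.23), (2.25)); every §§12–17 display is written with
one `β₆`: `k₁ = k₃`. [cite: Zhang2022LandauSiegel, §2 (2.23), (2.25)] -/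
def Theta.tiedOuterShifts (θ : Theta) : Prop := θ.k1 = θ.k3

/-- **The admissible class `R`**: all explicit side conditions of §§7–18 on the design parameters,
as architected (module docstring table). `ι₂, ι₃, ι₄` are unconstrained.
[cite: Zhang2022LandauSiegel, §§2, 7, 8, 9, 12, 14, 15] -/
def AdmissibleTheta (θ : Theta) : Prop :=
  θ.orderedLengths ∧ θ.straddleHalf ∧ θ.belowP ∧ θ.dualRangesNonempty ∧ θ.cutAtHalf ∧
    θ.shiftsInContour ∧ θ.tiedOuterShifts

/-! ### The printed point and the printed-exponent `ι`-family are admissible -/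

/-- The printed-exponent family `(0.504, 0.5, 0.498; 3/2, 5/2, 3/2; w₂, w₃, w₄; 1/2)` is admissible
for every `ι = (w₂, w₃, w₄) ∈ ℂ³`. [cite: Zhang2022LandauSiegel, §2 (2.21)–(2.26)] -/
theorem admissible_thetaIota (w2 w3 w4 : ℂ) : AdmissibleTheta (thetaIota w2 w3 w4) := by
  unfold AdmissibleTheta Theta.orderedLengths Theta.straddleHalf Theta.belowP
    Theta.dualRangesNonempty Theta.cutAtHalf Theta.shiftsInContour Theta.tiedOuterShifts thetaIota
  norm_num

/-- The printed point `θ₀` is admissible (the class is not empty; the exclusions of record —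
`Skeleton.not_margin232`, `Section18AllIota.C232G_ge`, … — are statements about members of `R`).
[cite: Zhang2022LandauSiegel, §2 (2.21)–(2.26)] -/
theorem admissible_theta0 : AdmissibleTheta theta0 := by
  rw [← thetaIota_iota]; exact admissible_thetaIota _ _ _

/-! ### Consequences used downstream -/

/-- On the class all three exponents are positive and below `1`, and `1 − ν₁ < ν₃ < ν₂`.
[cite: Zhang2022LandauSiegel, §2 (2.21)] -/
theorem AdmissibleTheta.nu_bounds {θ : Theta} (h : AdmissibleTheta θ) :
    1 / 2 < θ.nu1 ∧ θ.nu1 < 1 ∧ 0 < θ.nu2 ∧ θ.nu2 ≤ 1 / 2 ∧ 0 < θ.nu3 ∧ θ.nu3 < 1 / 2 ∧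
      1 - θ.nu1 < θ.nu3 ∧ θ.nu3 < θ.nu2 ∧ θ.nu2 < θ.nu1 := by
  obtain ⟨⟨h32, h21⟩, ⟨h3, h2, h1⟩, hP, hd, -, -, -⟩ := h
  unfold Theta.belowP at hP
  unfold Theta.dualRangesNonempty at hd
  refine ⟨h1, hP, ?_, h2, ?_, h3, ?_, h32, h21⟩ <;> linarith

/-- On the class the derived windows of `RepairTheta` are positive: `0 < ν₁ − ν₂`, `0 < ν₂ − ν₃`,
`0 < ν₁ − cut₁`, `0 < ν₁ + ν₃ − 1 < ν₁ + ν₂ − 1`, and `0 < 1 − ν₁ < 1/2`.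
[cite: Zhang2022LandauSiegel, §8 (8.21); §9 (9.5); §12 (12.10), (12.13)] -/
theorem AdmissibleTheta.windows_pos {θ : Theta} (h : AdmissibleTheta θ) :
    0 < θ.s12 ∧ 0 < θ.s23 ∧ 0 < θ.win ∧ 0 < θ.L6 ∧ θ.L6 < θ.L7 ∧ 0 < θ.nu1pp ∧ θ.nu1pp < 1 / 2 := by
  obtain ⟨⟨h32, h21⟩, ⟨h3, h2, h1⟩, hP, hd, hc, -, -⟩ := h
  unfold Theta.belowP at hP
  unfold Theta.dualRangesNonempty at hd
  unfold Theta.cutAtHalf at hc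
  unfold Theta.s12 Theta.s23 Theta.win Theta.L6 Theta.L7 Theta.nu1pp
  rw [hc]
  refine ⟨?_, ?_, ?_, ?_, ?_, ?_, ?_⟩ <;> linarith

/-! ### Coordinates, the root box, the outer-box lemma -/

/-- The seven real coordinates of `θ` as a point of `ℕ → ℝ` (the format of
`Literature.Analysis.ValidatedNumerics.Box.mem`): `(ν₁, ν₂, ν₃, k₁, k₂, k₃, cut₁)` at indices
`0 … 6`, and `0` beyond. `ι` is not a coordinate (it is eliminated exactly, per cell, by the
positive-semidefiniteness certificates of `Section18AllIota`). [folklore] -/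
def Theta.coords (θ : Theta) : ℕ → ℝ := fun i =>
  [θ.nu1, θ.nu2, θ.nu3, θ.k1, θ.k2, θ.k3, θ.cut1].getD i 0

/-- [folklore] -/ @[simp] theorem Theta.coords_zero (θ : Theta) : θ.coords 0 = θ.nu1 := rfl
/-- [folklore] -/ @[simp] theorem Theta.coords_one (θ : Theta) : θ.coords 1 = θ.nu2 := rfl
/-- [folklore] -/ @[simp] theorem Theta.coords_two (θ : Theta) : θ.coords 2 = θ.nu3 := rfl
/-- [folklore] -/ @[simp] theorem Theta.coords_three (θ : Theta) : θ.coords 3 = θ.k1 := rfl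
/-- [folklore] -/ @[simp] theorem Theta.coords_four (θ : Theta) : θ.coords 4 = θ.k2 := rfl
/-- [folklore] -/ @[simp] theorem Theta.coords_five (θ : Theta) : θ.coords 5 = θ.k3 := rfl
/-- [folklore] -/ @[simp] theorem Theta.coords_six (θ : Theta) : θ.coords 6 = θ.cut1 := rfl
/-- [folklore] -/
private theorem Theta.coords_of_seven_le (θ : Theta) {i : ℕ} (hi : 7 ≤ i) : θ.coords i = 0 := by
  unfold Theta.coords
  rw [List.getD_eq_default]
  simpa using hi

/-- The ROOT BOX of the class in the seven real coordinates:
`[1/2, 1] × [0, 1/2] × [0, 1/2] × [0, 5] × [0, 5] × [0, 5] × [1/2, 1/2]` (rational, closed; the class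
is its subset cut out by the strict / coupled conjuncts). [folklore] -/
def rootBox : Box :=
  [(1/2, 1), (0, 1/2), (0, 1/2), (0, 5), (0, 5), (0, 5), (1/2, 1/2)]

/-- **Outer-box lemma**: the coordinates of an admissible `θ` lie in `rootBox`.
[cite: Zhang2022LandauSiegel, §2 (2.21)–(2.22)] -/
theorem coords_mem_rootBox {θ : Theta} (h : AdmissibleTheta θ) :
    rootBox.mem θ.coords := by
  have hb := h.nu_bounds
  obtain ⟨-, -, -, -, hc, ⟨⟨hk1, hk1'⟩, ⟨hk2, hk2'⟩, ⟨hk3, hk3'⟩⟩, -⟩ := h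
  unfold Theta.cutAtHalf at hc
  intro i
  match i with
  | 0 => simp only [Theta.coords_zero, rootBox, Box.ivl, List.getD_cons_zero]; push_cast; constructor <;> linarith
  | 1 => simp only [Theta.coords_one, rootBox, Box.ivl, List.getD_cons_succ,
      List.getD_cons_zero]; push_cast; constructor <;> linarith
  | 2 => simp only [Theta.coords_two, rootBox, Box.ivl, List.getD_cons_succ,
      List.getD_cons_zero]; push_cast; constructor <;> linarith
  | 3 => simp only [Theta.coords_three, rootBox, Box.ivl, List.getD_cons_succ,
      List.getD_cons_zero]; push_cast; constructor <;> linarith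
  | 4 => simp only [Theta.coords_four, rootBox, Box.ivl, List.getD_cons_succ,
      List.getD_cons_zero]; push_cast; constructor <;> linarith
  | 5 => simp only [Theta.coords_five, rootBox, Box.ivl, List.getD_cons_succ,
      List.getD_cons_zero]; push_cast; constructor <;> linarith
  | 6 => simp only [Theta.coords_six, rootBox, Box.ivl, List.getD_cons_succ,
      List.getD_cons_zero]; push_cast; constructor <;> linarith
  | n + 7 =>
      rw [Theta.coords_of_seven_le θ (by omega)]
      simp only [rootBox, Box.ivl, List.getD_cons_succ, List.getD_nil]
      push_cast; constructor <;> rfl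

/-- **From the root box to the class**: a property of the coordinates that holds at every point of
`rootBox` (for instance, one certified by a kd-tree cover, `KdCert.sound`) holds at every admissible
`θ` of [Zhang2022LandauSiegel]'s design space. [cite: Zhang2022LandauSiegel, §2 (2.21)–(2.26)] -/
theorem forall_admissible_of_forall_rootBox {P : (ℕ → ℝ) → Prop}
    (hP : ∀ x, rootBox.mem x → P x) : ∀ θ, AdmissibleTheta θ → P θ.coords :=
  fun _ h => hP _ (coords_mem_rootBox h)

/-! ### The class polytope in coordinates (for the cover's linear excluder) -/

/-- The CLOSURE of the class `R` in the seven coordinates, as affine constraints `Σ aᵢ xᵢ ≤ d`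
(`RepairCoverFrame.LinCon`; coordinates `0 … 6 = ν₁, ν₂, ν₃, k₁, k₂, k₃, cut₁`), in the order:
`ν₂ ≤ ν₁`, `ν₃ ≤ ν₂`, `1/2 ≤ ν₁`, `ν₁ ≤ 1`, `ν₂ ≤ 1/2`, `ν₃ ≤ 1/2`, `1 ≤ ν₁ + ν₃`, `0 ≤ k_μ ≤ 5`
(`μ = 1, 2, 3`), `k₁ = k₃` (two inequalities), `cut₁ = 1/2` (two inequalities). Strict conjuncts of
`AdmissibleTheta` are relaxed to their closures (sound for EXCLUDING cells: a cell on which one of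
these fails contains no admissible point). [cite: Zhang2022LandauSiegel, §2 (2.21)–(2.22); §12 (12.1)] -/
def admissibleLinCons : List LinCon :=
  [⟨[-1, 1], 0⟩, ⟨[0, -1, 1], 0⟩, ⟨[-1], -1/2⟩, ⟨[1], 1⟩, ⟨[0, 1], 1/2⟩, ⟨[0, 0, 1], 1/2⟩,
   ⟨[-1, 0, -1], -1⟩,
   ⟨[0, 0, 0, -1], 0⟩, ⟨[0, 0, 0, 1], 5⟩, ⟨[0, 0, 0, 0, -1], 0⟩, ⟨[0, 0, 0, 0, 1], 5⟩,
   ⟨[0, 0, 0, 0, 0, -1], 0⟩, ⟨[0, 0, 0, 0, 0, 1], 5⟩,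
   ⟨[0, 0, 0, 1, 0, -1], 0⟩, ⟨[0, 0, 0, -1, 0, 1], 0⟩,
   ⟨[0, 0, 0, 0, 0, 0, 1], 1/2⟩, ⟨[0, 0, 0, 0, 0, 0, -1], -1/2⟩]

/-- An admissible `θ` satisfies every constraint of the class polytope.
[cite: Zhang2022LandauSiegel, §2 (2.21)–(2.22); §12 (12.1)] -/
theorem linHolds_of_admissible {θ : Theta} (h : AdmissibleTheta θ) :
    LinHolds admissibleLinCons θ.coords := by
  have hb := h.nu_bounds
  obtain ⟨-, -, -, -, hc, ⟨⟨hk1, hk1'⟩, ⟨hk2, hk2'⟩, ⟨hk3, hk3'⟩⟩, ht⟩ := h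
  unfold Theta.cutAtHalf at hc
  unfold Theta.tiedOuterShifts at ht
  intro c hc'
  simp only [admissibleLinCons, List.mem_cons, List.mem_nil_iff, or_false] at hc'
  rcases hc' with rfl | rfl | rfl | rfl | rfl | rfl | rfl | rfl | rfl | rfl | rfl | rfl | rfl | rfl |
    rfl | rfl | rfl
  all_goals
    simp only [LinCon.Holds, linEval, zero_add, Nat.reduceAdd, Theta.coords_zero, Theta.coords_one,
      Theta.coords_two, Theta.coords_three, Theta.coords_four, Theta.coords_five, Theta.coords_six]
    push_cast
    linarith

/-- The two hypotheses of `RepairCoverFrame.forall_class_of_cover` for this class and the single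
root `rootBox` (with any certificate tree `t`): an admissible `θ` is covered and lies in the
polytope. [cite: Zhang2022LandauSiegel, §2 (2.21)–(2.22); §12 (12.1)] -/
theorem admissible_coverHyp {α : Type} (t : KdCert α) {θ : Theta} (h : AdmissibleTheta θ) :
    CoverMem [(rootBox, t)] θ.coords ∧ LinHolds admissibleLinCons θ.coords :=
  ⟨⟨(rootBox, t), List.mem_cons_self, coords_mem_rootBox h⟩, linHolds_of_admissible h⟩

/-- **From a certified cover of `rootBox` to the class.** If a property `P` of the coordinates holds
at every covered point of the polytope (this is what `coverCheck_sound` /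
`posSemidef_of_coverCheck` deliver for the cover `[(rootBox, t)]` with the linear excluder
`linExcl admissibleLinCons`), then `P` holds at every admissible `θ`.
[cite: Zhang2022LandauSiegel, §2 (2.21)–(2.22); §12 (12.1)] -/
theorem forall_admissible_of_cover {α : Type} {P : (ℕ → ℝ) → Prop} (t : KdCert α)
    (hP : ∀ x, CoverMem [(rootBox, t)] x → LinHolds admissibleLinCons x → P x) :
    ∀ θ, AdmissibleTheta θ → P θ.coords :=
  forall_class_of_cover [(rootBox, t)] (fun _ h => admissible_coverHyp t h) hP

/-- **Sub-box version** (the form the numerics lineages certify: a compact design box `K` inside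
`rootBox`, e.g. a neighbourhood of the printed point): a property certified on the cover `[(K, t)]`
of `K` (polytope-excluded leaves allowed) holds at every admissible `θ` whose coordinates lie in `K`.
[cite: Zhang2022LandauSiegel, §2 (2.21)–(2.22); §12 (12.1)] -/
theorem forall_admissible_in_of_cover {α : Type} {P : (ℕ → ℝ) → Prop} (K : Box) (t : KdCert α)
    (hP : ∀ x, CoverMem [(K, t)] x → LinHolds admissibleLinCons x → P x) :
    ∀ θ, AdmissibleTheta θ → K.mem θ.coords → P θ.coords :=
  fun _ h hK => hP _ ⟨(K, t), List.mem_cons_self, hK⟩ (linHolds_of_admissible h)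

/-- **Several roots** (a cover assembled from finitely many design boxes, each with its own tree):
a property certified on all of them holds at every admissible `θ` covered by one of them.
[cite: Zhang2022LandauSiegel, §2 (2.21)–(2.22); §12 (12.1)] -/
theorem forall_admissible_covered_of_cover {α : Type} {P : (ℕ → ℝ) → Prop}
    (roots : List (Box × KdCert α))
    (hP : ∀ x, CoverMem roots x → LinHolds admissibleLinCons x → P x) :
    ∀ θ, AdmissibleTheta θ → CoverMem roots θ.coords → P θ.coords :=
  fun _ h hc => hP _ hc (linHolds_of_admissible h)

end Repair

end Literature.NumberTheory.LFunctions.Zhang2022
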